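import Literature.Analysis.FluidPDE.ExtremeGrowthBounds
import HarnessLib

/-!
# The energy–enstrophy product `K·ℰ` is non-increasing below the Lu–Doering small-data threshold — PROVED (from the Lu–Doering estimate)

Analysis/FluidPDE proof file (theorems only: no definitions, no named facts), companion of
`ExtremeGrowthBounds.lean`.

Setting as there: unforced Navier–Stokes on the unit 3-torus, zero-mean classical solutions
`Torus.IsClassicalNSSolutionOn (Icc a b) ν 0 u p`, `K = Torus.kineticEnergy = ½‖u‖₂²`,
`ℰ = torusEnstrophy = ½‖∇u‖₂²`, `C_LD(ν) = luDoeringConst ν = 27/(8π⁴ν³)`, small-data threshold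
`K ℰ < (2πν)⁴/27 = luDoeringSmallDataThreshold ν = 2ν/C_LD` (Ayala–Protas 2017, (2.11)–(2.12)).

From `dK/dt = -2νℰ` (energy balance, in the tree) and the Lu–Doering estimate `dℰ/dt ≤ C_LD ℰ³`
(the named fact `LuDoering2008_enstrophyRate_le`, taken as a hypothesis — nothing new is assumed):

`d(Kℰ)/dt = -2νℰ² + K dℰ/dt ≤ ℰ² (-2ν + C_LD K ℰ)`,

so `t ↦ K(t)ℰ(t)` is non-increasing on every window on which `C_LD K ℰ ≤ 2ν`, i.e.
`K ℰ ≤ (2πν)⁴/27`; and since `K` is non-increasing and `ℰ(t) ≤ ℰ(a)/(1 − σ)`,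
`σ = 27K(a)ℰ(a)/(2πν)⁴` (`torusEnstrophy_le_of_small`), the window condition holds on all of
`[a, b]` as soon as `σ ≤ ½`. This is the small-data monotonicity behind Ayala–Protas (2.10)–(2.12)
("for sufficiently small data the enstrophy stays bounded"), in the product form used as a
control row by the functional-mining census (pub-nsfunc DICTIONARY §13, row P0-05 `EQ.KZ | T_M0`:
"PASS iff 27·E·Z/(2πν)⁴ < 1").

* `hasDerivWithinAt_kineticEnergy_mul_torusEnstrophy_le` — the rate bound `R_{Kℰ} ≤ ℰ²(C_LD Kℰ - 2ν)`;
* `antitoneOn_kineticEnergy_mul_torusEnstrophy` — `Kℰ` non-increasing on `[a, b]` if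
  `K(s)ℰ(s) ≤ (2πν)⁴/27` for all `s ∈ [a, b]`;
* `antitoneOn_kineticEnergy_mul_torusEnstrophy_of_half` — the same under the initial condition
  `27 K(a)ℰ(a)/(2πν)⁴ ≤ ½` only.

## Mathlib / tree search

Tree: `LuDoering2008_enstrophyRate_le`, `luDoeringConst`, `luDoeringSmallDataThreshold(_eq)`,
`luDoeringConst_div_two_nu`, `torusEnstrophy_le_of_small`, `Torus.IsClassicalNSSolutionOn.energy_balance_holds`,
`…hasDerivWithinAt_half_gradNormSq`, `gradNormSq_eq_two_mul_torusEnstrophy`; Mathlib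
`antitoneOn_of_hasDerivWithinAt_nonpos`. `lean search 'kineticEnergy_mul_torusEnstrophy'`: nothing.

## References

* D. Ayala, B. Protas, J. Fluid Mech. 818 (2017) 772–806 = arXiv:1605.05742, eqs. (2.5)–(2.12)
  (held text p. 5). [AyalaProtas2017]
* L. Lu, C. R. Doering, Indiana Univ. Math. J. 57 (2008) 2693–2727. [LuDoering2008]
-/

noncomputable section

open Set MeasureTheory
open scoped InnerProductSpace RealInnerProductSpace

namespace Literature.Analysis.FluidPDE

open Literature.Analysis.FunctionSpaces

variable {d : Type*} [Fintype d] [DecidableEq d]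

/-- **Rate of the energy–enstrophy product** (Ayala–Protas (2.5)–(2.7) combined): under the
Lu–Doering estimate, along a zero-mean classical solution of unforced Navier–Stokes (`ν > 0`) on
`T³ × [a, b]`, `a < b`, the function `s ↦ K(u s) ℰ(u s)` has, at every `t ∈ [a, b]`, a one-sided
derivative `R` within `[a, b]` with `R ≤ ℰ(u t)² (C_LD(ν) K(u t) ℰ(u t) − 2ν)`.
[cite: AyalaProtas2017, eqs. (2.5)–(2.7)] -/
theorem hasDerivWithinAt_kineticEnergy_mul_torusEnstrophy_le
    (hLD : LuDoering2008_enstrophyRate_le (d := d)) (hd : Fintype.card d = 3)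
    {ν a b : ℝ} (hν : 0 < ν) (hab : a < b)
    {u : ℝ → UnitAddTorus d → EuclideanSpace ℝ d} {p : ℝ → UnitAddTorus d → ℝ}
    (h : Torus.IsClassicalNSSolutionOn (Icc a b) ν 0 u p)
    (hmean : ∀ t ∈ Icc a b, Torus.HasZeroMean (u t)) {t : ℝ} (ht : t ∈ Icc a b) :
    ∃ R : ℝ, HasDerivWithinAt (fun s => Torus.kineticEnergy (u s) * torusEnstrophy (u s)) R (Icc a b) t ∧
      R ≤ torusEnstrophy (u t) ^ 2 *
        (luDoeringConst ν * Torus.kineticEnergy (u t) * torusEnstrophy (u t) - 2 * ν) := by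
  set F : ℝ := -ν * (∫ x, ‖Torus.laplacian (u t) x‖ ^ 2) +
      ∫ x, ⟪Torus.convect (u t) (u t) x - (0 : ℝ → UnitAddTorus d → EuclideanSpace ℝ d) t x,
        Torus.laplacian (u t) x⟫_ℝ with hF
  have hE : HasDerivWithinAt (fun r => torusEnstrophy (u r)) F (Icc a b) t :=
    h.hasDerivWithinAt_half_gradNormSq hab ht
  have hK : HasDerivWithinAt (fun r => Torus.kineticEnergy (u r))
      (-ν * Torus.gradNormSq (u t)) (Icc a b) t := by
    have hb := Torus.IsClassicalNSSolutionOn.energy_balance_holds h (convex_Icc a b) ht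
    simpa using hb
  have hle : F ≤ luDoeringConst ν * torusEnstrophy (u t) ^ 3 := hLD hd hν hab h hmean t ht F hE
  refine ⟨-ν * Torus.gradNormSq (u t) * torusEnstrophy (u t) + Torus.kineticEnergy (u t) * F,
    hK.mul hE, ?_⟩
  have hK0 : 0 ≤ Torus.kineticEnergy (u t) := Torus.kineticEnergy_nonneg _
  have h1 : Torus.kineticEnergy (u t) * F ≤
      Torus.kineticEnergy (u t) * (luDoeringConst ν * torusEnstrophy (u t) ^ 3) :=
    mul_le_mul_of_nonneg_left hle hK0
  rw [gradNormSq_eq_two_mul_torusEnstrophy]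
  nlinarith [h1]

/-- **`K·ℰ` is non-increasing below the threshold** (control form of Ayala–Protas (2.10)–(2.12)):
under the Lu–Doering estimate, along a zero-mean classical solution of unforced Navier–Stokes
(`ν > 0`) on `T³ × [a, b]`, `a < b`, if `K(u s) ℰ(u s) ≤ (2πν)⁴/27 = luDoeringSmallDataThreshold ν`
for every `s ∈ [a, b]`, then `s ↦ K(u s) ℰ(u s)` is non-increasing on `[a, b]`.
[cite: AyalaProtas2017, eqs. (2.10)–(2.12)] -/
theorem antitoneOn_kineticEnergy_mul_torusEnstrophy
    (hLD : LuDoering2008_enstrophyRate_le (d := d)) (hd : Fintype.card d = 3)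
    {ν a b : ℝ} (hν : 0 < ν) (hab : a < b)
    {u : ℝ → UnitAddTorus d → EuclideanSpace ℝ d} {p : ℝ → UnitAddTorus d → ℝ}
    (h : Torus.IsClassicalNSSolutionOn (Icc a b) ν 0 u p)
    (hmean : ∀ t ∈ Icc a b, Torus.HasZeroMean (u t))
    (hsmall : ∀ s ∈ Icc a b,
      Torus.kineticEnergy (u s) * torusEnstrophy (u s) ≤ luDoeringSmallDataThreshold ν) :
    AntitoneOn (fun s => Torus.kineticEnergy (u s) * torusEnstrophy (u s)) (Icc a b) := by
  have hC0 : 0 < luDoeringConst ν := luDoeringConst_pos hν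
  -- choose the derivative values
  choose R hR hRle using fun s (hs : s ∈ Icc a b) =>
    hasDerivWithinAt_kineticEnergy_mul_torusEnstrophy_le hLD hd hν hab h hmean hs
  classical
  set R' : ℝ → ℝ := fun s => if hs : s ∈ Icc a b then R s hs else 0 with hR'
  have hR's : ∀ s (hs : s ∈ Icc a b), R' s = R s hs := fun s hs => by
    simp only [hR']
    rw [dif_pos hs]
  have hder : ∀ s ∈ Icc a b, HasDerivWithinAt
      (fun s => Torus.kineticEnergy (u s) * torusEnstrophy (u s)) (R' s) (Icc a b) s := by
    intro s hs; rw [hR's s hs]; exact hR s hs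
  refine antitoneOn_of_hasDerivWithinAt_nonpos (convex_Icc a b)
    (fun s hs => (hder s hs).continuousWithinAt)
    (fun s hs => (hder s (interior_subset hs)).mono interior_subset) fun s hs => ?_
  rw [interior_Icc] at hs
  have hs' : s ∈ Icc a b := Ioo_subset_Icc_self hs
  rw [hR's s hs']
  have hthr : luDoeringConst ν * Torus.kineticEnergy (u s) * torusEnstrophy (u s) ≤ 2 * ν := by
    have h1 := hsmall s hs'
    rw [luDoeringSmallDataThreshold_eq hν.ne', le_div_iff₀ hC0] at h1
    linarith [h1]
  have hE2 : 0 ≤ torusEnstrophy (u s) ^ 2 := sq_nonneg _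
  calc R s hs' ≤ torusEnstrophy (u s) ^ 2 *
        (luDoeringConst ν * Torus.kineticEnergy (u s) * torusEnstrophy (u s) - 2 * ν) := hRle s hs'
    _ ≤ 0 := mul_nonpos_of_nonneg_of_nonpos hE2 (by linarith)

/-- **Small initial product suffices** (`σ ≤ ½`): under the Lu–Doering estimate, along a zero-mean
classical solution of unforced Navier–Stokes (`ν > 0`) on `T³ × [a, b]`, `a < b`, with positive
enstrophy, if `27 K(u a) ℰ(u a)/(2πν)⁴ ≤ ½` then `K ℰ` is non-increasing on `[a, b]` (because
`K(t) ≤ K(a)` and `ℰ(t) ≤ ℰ(a)/(1 − σ) ≤ 2ℰ(a)` by `torusEnstrophy_le_of_small`, so the window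
condition `K ℰ ≤ (2πν)⁴/27` holds throughout). [cite: AyalaProtas2017, eqs. (2.10)–(2.12)] -/
theorem antitoneOn_kineticEnergy_mul_torusEnstrophy_of_half
    (hLD : LuDoering2008_enstrophyRate_le (d := d)) (hd : Fintype.card d = 3)
    {ν a b : ℝ} (hν : 0 < ν) (hab : a < b)
    {u : ℝ → UnitAddTorus d → EuclideanSpace ℝ d} {p : ℝ → UnitAddTorus d → ℝ}
    (h : Torus.IsClassicalNSSolutionOn (Icc a b) ν 0 u p)
    (hmean : ∀ t ∈ Icc a b, Torus.HasZeroMean (u t))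
    (hpos : ∀ t ∈ Icc a b, 0 < torusEnstrophy (u t))
    (hσ : luDoeringConst ν / (2 * ν) * Torus.kineticEnergy (u a) * torusEnstrophy (u a) ≤ 2⁻¹) :
    AntitoneOn (fun s => Torus.kineticEnergy (u s) * torusEnstrophy (u s)) (Icc a b) := by
  have hC0 : 0 < luDoeringConst ν := luDoeringConst_pos hν
  have ha : a ∈ Icc a b := left_mem_Icc.2 hab.le
  set σ : ℝ := luDoeringConst ν / (2 * ν) * Torus.kineticEnergy (u a) * torusEnstrophy (u a) with hσdef
  have hσ1 : σ < 1 := by linarith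
  have hσ0 : 0 ≤ σ := by
    have := Torus.kineticEnergy_nonneg (u a)
    have := (hpos a ha).le
    positivity
  refine antitoneOn_kineticEnergy_mul_torusEnstrophy hLD hd hν hab h hmean fun s hs => ?_
  -- `K(s) ≤ K(a)`: energy is non-increasing
  have hKmono : Torus.kineticEnergy (u s) ≤ Torus.kineticEnergy (u a) := by
    have hK : ∀ r ∈ Icc a b, HasDerivWithinAt (fun r => Torus.kineticEnergy (u r))
        (-ν * Torus.gradNormSq (u r)) (Icc a b) r := by
      intro r hr
      have hb := Torus.IsClassicalNSSolutionOn.energy_balance_holds h (convex_Icc a b) hr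
      simpa using hb
    have hanti : AntitoneOn (fun r => Torus.kineticEnergy (u r)) (Icc a b) :=
      antitoneOn_of_hasDerivWithinAt_nonpos (convex_Icc a b)
        (fun r hr => (hK r hr).continuousWithinAt)
        (fun r hr => (hK r (interior_subset hr)).mono interior_subset) fun r _ =>
          mul_nonpos_of_nonpos_of_nonneg (by linarith) (Torus.gradNormSq_nonneg _)
    exact hanti ha hs hs.1
  -- `ℰ(s) ≤ ℰ(a)/(1 − σ)`
  have hEs := torusEnstrophy_le_of_small hLD hd hν hab h hmean hpos hσ1 hs
  have hKa0 : 0 ≤ Torus.kineticEnergy (u a) := Torus.kineticEnergy_nonneg _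
  have hKs0 : 0 ≤ Torus.kineticEnergy (u s) := Torus.kineticEnergy_nonneg _
  have hEa0 : 0 ≤ torusEnstrophy (u a) := (hpos a ha).le
  have h1σ : 0 < 1 - σ := by linarith
  -- `K(s)ℰ(s) ≤ K(a)ℰ(a)/(1 − σ) ≤ 2ν/C · (σ/(1−σ)) ≤ 2ν/C`
  have hprod : Torus.kineticEnergy (u s) * torusEnstrophy (u s) ≤
      Torus.kineticEnergy (u a) * (torusEnstrophy (u a) / (1 - σ)) :=
    mul_le_mul hKmono hEs (hpos s hs).le hKa0
  rw [luDoeringSmallDataThreshold_eq hν.ne']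
  refine hprod.trans ?_
  rw [mul_div_assoc', div_le_div_iff₀ h1σ hC0]
  -- `K(a)ℰ(a) · C = 2ν σ`, so the claim is `2νσ ≤ 2ν(1 − σ)`, i.e. `σ ≤ ½`
  have hKE : Torus.kineticEnergy (u a) * torusEnstrophy (u a) * luDoeringConst ν = 2 * ν * σ := by
    rw [hσdef]; field_simp
  rw [hKE]
  nlinarith [hσ, hν]

end Literature.Analysis.FluidPDE
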